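import Mathlib
import Summits.AtomisticToContinuum.Crystallization.Theses.PhononSlackCertificates
import Summits.AtomisticToContinuum.Crystallization.Theorems.PhononSlackCertificatesNearFarGlueRCoverFccSharp
import Summits.AtomisticToContinuum.Crystallization.Theorems.PhononSlackCertificatesNearFarGlueRCoverHcpSharp

/-!
# Route `PhononSlackCertificates`, crux `NearFieldConvexity` (stmt-AtomisticToContinuum-13958), line `Sketch`:
stub `stub_segmentCrossing`

SEGMENT CROSSING.  Let `Ω` be a set of `1/20`-good particles of a configuration `x : Fin N → ℝ³`,
`i ∈ Ω` a radius-4 INTERIOR particle (every particle within `4` of `x i` is in `Ω`) and `j ∉ Ω`.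
Then some radius-4 BOUNDARY particle `b ∈ Ω` (one having a non-member within `4`) lies within
distance `1` of the segment `[x i, x j]`.

Proof.  (1) HOP (`segment_hop`): from a good particle `q` and a point `y ≠ x q` at distance `t`, the
occupied first-shell site of `q` best aligned with `y - x q` (the landed `2/3`-covering facts
`PhononSlackCertificatesNearFarGlueR.stub_coverFccSharp / stub_coverHcpSharp`) is a particle `p`
with `dist (x p) (x q) ≤ 21/20` and `dist y (x p)² ≤ t² + 441/400 − (1739/1500) t`.
(2) COVER (`segment_cover`): if every particle within `4` of `x a'` is good and `dist y (x a') ≤ 2`,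
six hops (explicit decreasing bounds `2, 1.669, 1.398, 1.199, 1.073, 1.005, 1`) reach a particle
within `1` of `y` and within `4` of `x a'`.  (3) SUP: let `t*` be the largest parameter in `[0,1]` at
which the moving point `x i + t (x j − x i)` is within `1` of an interior particle (a closed, bounded,
non-empty set); `t* < 1`, and at `t' = min 1 (t* + 1/|x i − x j|)` the point is within `2` of that
interior particle, hence within `1` of a particle of `Ω`, which cannot be interior by maximality.
-/

noncomputable section

open scoped BigOperators InnerProductSpace RealInnerProductSpace
open Literature.MathematicalPhysics.StatisticalMechanics Literature.Geometry.DiscreteGeometry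

namespace Summit.AtomisticToContinuum.Crystallization.Theorems.PhononSlackNearFieldConvexity

open Summit.AtomisticToContinuum.Crystallization.Theorems.PhononSlackCertificatesNearFarGlueR
  (stub_coverFccSharp stub_coverHcpSharp)

/-- **Core estimate of the hop.**  `‖p‖ = t`, `‖z‖ = a` with `47/50 ≤ a ≤ 1`, `‖w - z‖ ≤ a/20`,
`⟪p, z⟫ ≥ (2/3) t a`; then `‖w‖ ≤ 21/20` and `‖p - w‖² ≤ t² + 441/400 − (1739/1500) t`. [folklore] -/
theorem segment_hop_core {p w z : EuclideanSpace ℝ (Fin 3)} {t a : ℝ} (ht : 0 ≤ t)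
    (ha1 : 47 / 50 ≤ a) (ha2 : a ≤ 1) (hp : ‖p‖ = t) (hz : ‖z‖ = a) (hwz : ‖w - z‖ ≤ a / 20)
    (hinner : 2 / 3 * t * a ≤ ⟪p, z⟫) :
    ‖w‖ ≤ 21 / 20 ∧ ‖p - w‖ ^ 2 ≤ t ^ 2 + 441 / 400 - 1739 / 1500 * t := by
  have ha0 : 0 < a := by linarith
  have hw : ‖w‖ ≤ 21 / 20 * a := by
    have h := norm_sub_norm_le w z
    linarith
  refine ⟨by nlinarith, ?_⟩
  have h1 : |⟪p, w - z⟫| ≤ t * (a / 20) := by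
    calc |⟪p, w - z⟫| ≤ ‖p‖ * ‖w - z‖ := abs_real_inner_le_norm p (w - z)
      _ ≤ t * (a / 20) := by
          rw [hp]
          exact mul_le_mul_of_nonneg_left hwz ht
  have h1' := (abs_le.1 h1).1
  have h2 : ⟪p, w⟫ = ⟪p, z⟫ + ⟪p, w - z⟫ := by
    rw [inner_sub_right]
    ring
  have h3 : 37 / 60 * t * a ≤ ⟪p, w⟫ := by
    rw [h2]
    linarith
  have hww : ‖w‖ ^ 2 ≤ (21 / 20 * a) ^ 2 := pow_le_pow_left₀ (norm_nonneg w) hw 2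
  have hta : t * (47 / 50) ≤ t * a := mul_le_mul_of_nonneg_left ha1 ht
  rw [norm_sub_sq_real, hp]
  nlinarith

/-- **Hop.**  From a `1/20`-good particle `q` and a point `y ≠ x q` at distance `t`, some particle
`p ≠ q` within `21/20` of `x q` satisfies `dist y (x p)² ≤ t² + 441/400 − (1739/1500) t`.
[folklore] -/
theorem segment_hop {N : ℕ} (x : Fin N → EuclideanSpace ℝ (Fin 3)) {q : Fin N}
    (hq : IsTwoShellGood (1 / 20) (47 / 50) 1 x q) (y : EuclideanSpace ℝ (Fin 3)) (hy : y ≠ x q) :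
    ∃ p : Fin N, p ≠ q ∧ dist (x p) (x q) ≤ 21 / 20 ∧
      dist y (x p) ^ 2 ≤ dist y (x q) ^ 2 + 441 / 400 - 1739 / 1500 * dist y (x q) := by
  obtain ⟨a, ha1, ha2, A, P, f, hP, hf, -, -⟩ := hq
  have hcov : ∀ w : EuclideanSpace ℝ (Fin 3), ‖w‖ = 1 →
      ∃ v ∈ P, ‖v‖ = 1 ∧ (2 / 3 : ℝ) ≤ ⟪v, w⟫ := by
    rcases hP with rfl | rfl
    exacts [stub_coverFccSharp, stub_coverHcpSharp]
  have ha0 : 0 < a := by linarith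
  set t := dist y (x q) with ht_def
  have ht0 : 0 < t := dist_pos.2 hy
  set p : EuclideanSpace ℝ (Fin 3) := y - x q with hp_def
  have hp : ‖p‖ = t := by rw [ht_def, dist_eq_norm]
  set u : EuclideanSpace ℝ (Fin 3) := t⁻¹ • p with hu_def
  have hu : ‖u‖ = 1 := by
    rw [hu_def, norm_smul, norm_inv, Real.norm_of_nonneg ht0.le, hp, inv_mul_cancel₀ ht0.ne']
  have hpu : p = t • u := by rw [hu_def, smul_smul, mul_inv_cancel₀ ht0.ne', one_smul]
  set w : EuclideanSpace ℝ (Fin 3) := (A.toLinearIsometryEquiv rfl).symm u with hw_def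
  have hw : ‖w‖ = 1 := by rw [hw_def, LinearIsometryEquiv.norm_map, hu]
  have hAw : A w = u := by
    rw [hw_def, ← LinearIsometry.coe_toLinearIsometryEquiv A rfl]
    exact (A.toLinearIsometryEquiv rfl).apply_symm_apply u
  obtain ⟨v, hv, hv1, hvw⟩ := hcov w hw
  have hAvu : (2 / 3 : ℝ) ≤ ⟪u, A v⟫ := by
    rw [← hAw, LinearIsometry.inner_map_map, real_inner_comm]
    exact hvw
  obtain ⟨hki, hk⟩ := hf v hv
  have hz : ‖a • A v‖ = a := by
    rw [norm_smul, Real.norm_of_nonneg ha0.le, A.norm_map, hv1, mul_one]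
  have hyz : ‖x (f v) - x q - a • A v‖ ≤ a / 20 := by
    rw [dist_eq_norm, sub_add_eq_sub_sub] at hk
    linarith
  have hinner : 2 / 3 * t * a ≤ ⟪p, a • A v⟫ := by
    rw [hpu, real_inner_smul_left, real_inner_smul_right]
    have h := mul_le_mul_of_nonneg_left hAvu (mul_pos ht0 ha0).le
    calc 2 / 3 * t * a = t * a * (2 / 3) := by ring
      _ ≤ t * a * ⟪u, A v⟫ := h
      _ = t * (a * ⟪u, A v⟫) := by ring
  obtain ⟨h1, h2⟩ := segment_hop_core ht0.le ha1 ha2 hp hz hyz hinner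
  refine ⟨f v, hki, ?_, ?_⟩
  · rwa [dist_eq_norm]
  · have : dist y (x (f v)) = ‖p - (x (f v) - x q)‖ := by
      rw [dist_eq_norm, hp_def, sub_sub_sub_cancel_right]
    rw [this]
    exact h2

section Cover

variable {N : ℕ} (x : Fin N → EuclideanSpace ℝ (Fin 3)) (a' : Fin N)
  (h4 : ∀ k : Fin N, dist (x k) (x a') ≤ 4 → IsTwoShellGood (1 / 20) (47 / 50) 1 x k)
  (y : EuclideanSpace ℝ (Fin 3)) (hy : dist y (x a') ≤ 2)

include h4 hy

/-- One stage of the cover iteration: from a particle `q` within `4` of the anchor and within `B ≤ 2`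
of `y` (with `B' ≥ 1`, `B² + 441/400 − (1739/1500) B ≤ B'²`), either `q` is already within `1` of `y`
or a hop produces a particle within `B'` of `y` (and within `4` of the anchor). [folklore] -/
theorem segment_stage {B B' : ℝ} (hB'1 : 1 ≤ B') (hB'2 : B' ≤ 2)
    (hBB' : B ^ 2 + 441 / 400 - 1739 / 1500 * B ≤ B' ^ 2) (q : Fin N)
    (hqa : dist (x q) (x a') ≤ 4) (hqy : dist y (x q) ≤ B) :
    ∃ p : Fin N, dist (x p) (x a') ≤ 4 ∧ (dist y (x p) ≤ 1 ∨ dist y (x p) ≤ B') := by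
  by_cases h1 : dist y (x q) ≤ 1
  · exact ⟨q, hqa, Or.inl h1⟩
  push Not at h1
  have hyq : y ≠ x q := by
    intro h
    rw [h, dist_self] at h1
    linarith
  obtain ⟨p, -, -, hp⟩ := segment_hop x (h4 q hqa) y hyq
  have ht1 : 1 ≤ dist y (x q) := h1.le
  have hkey : dist y (x p) ^ 2 ≤ B' ^ 2 := by
    have hmono : dist y (x q) ^ 2 - 1739 / 1500 * dist y (x q) ≤ B ^ 2 - 1739 / 1500 * B := by
      nlinarith [mul_nonneg (sub_nonneg.2 hqy) (by linarith : (0 : ℝ) ≤ dist y (x q) + B - 1739 / 1500)]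
    linarith
  have hdp : dist y (x p) ≤ B' := le_of_pow_le_pow_left₀ two_ne_zero (by linarith) hkey
  refine ⟨p, ?_, Or.inr hdp⟩
  calc dist (x p) (x a') ≤ dist (x p) y + dist y (x a') := dist_triangle _ _ _
    _ ≤ B' + 2 := by rw [dist_comm]; linarith
    _ ≤ 4 := by linarith

/-- **Cover.**  If every particle within `4` of `x a'` is `1/20`-good, every point `y` within `2` of
`x a'` is within `1` of some particle lying within `4` of `x a'` (six hops through first
coordination shells, with the explicit bounds `2 → 1.669 → 1.398 → 1.199 → 1.073 → 1.005 → 1`).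
[folklore] -/
theorem segment_cover : ∃ p : Fin N, dist y (x p) ≤ 1 ∧ dist (x p) (x a') ≤ 4 := by
  have h0 : dist (x a') (x a') ≤ 4 := by rw [dist_self]; norm_num
  -- stage 1: from `a'` itself (`B = 2`) to `B' = 1669/1000`
  obtain ⟨p1, hp1a, h1 | h1⟩ := segment_stage x a' h4 y hy (B := 2) (B' := 1669 / 1000)
    (by norm_num) (by norm_num) (by norm_num) a' h0 hy
  · exact ⟨p1, h1, hp1a⟩
  obtain ⟨p2, hp2a, h2 | h2⟩ := segment_stage x a' h4 y hy (B := 1669 / 1000) (B' := 1398 / 1000)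
    (by norm_num) (by norm_num) (by norm_num) p1 hp1a h1
  · exact ⟨p2, h2, hp2a⟩
  obtain ⟨p3, hp3a, h3 | h3⟩ := segment_stage x a' h4 y hy (B := 1398 / 1000) (B' := 1199 / 1000)
    (by norm_num) (by norm_num) (by norm_num) p2 hp2a h2
  · exact ⟨p3, h3, hp3a⟩
  obtain ⟨p4, hp4a, h4' | h4'⟩ := segment_stage x a' h4 y hy (B := 1199 / 1000) (B' := 1073 / 1000)
    (by norm_num) (by norm_num) (by norm_num) p3 hp3a h3
  · exact ⟨p4, h4', hp4a⟩
  obtain ⟨p5, hp5a, h5 | h5⟩ := segment_stage x a' h4 y hy (B := 1073 / 1000) (B' := 1005 / 1000)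
    (by norm_num) (by norm_num) (by norm_num) p4 hp4a h4'
  · exact ⟨p5, h5, hp5a⟩
  obtain ⟨p6, hp6a, h6 | h6⟩ := segment_stage x a' h4 y hy (B := 1005 / 1000) (B' := 1)
    (by norm_num) (by norm_num) (by norm_num) p5 hp5a h5
  · exact ⟨p6, h6, hp6a⟩
  · exact ⟨p6, h6, hp6a⟩

end Cover

/-- **Stub (geometry): SEGMENT CROSSING.**  If `Ω` consists of good particles, `i ∈ Ω` is a
radius-4 interior particle and `j ∉ Ω`, then some radius-4 BOUNDARY particle `b` of `Ω` lies within
distance `1` of the segment `[x i, x j]`.  (Proof: let `t*` be the last parameter at which the moving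
point is within `1` of an interior particle `a'`; slightly later it is within `2` of `a'`, hence —
hopping ≤ 6 times through first coordination shells, `2/3`-covering — within `49/50` of a particle
of `Ω`, which cannot be interior.) -/
theorem stub_segmentCrossing :
    ∀ (N : ℕ) (x : Fin N → EuclideanSpace ℝ (Fin 3)) (Ω : Finset (Fin N)),
      (∀ i ∈ Ω, IsTwoShellGood (1 / 20) (47 / 50) 1 x i) →
      ∀ i ∈ Ω, (∀ k : Fin N, dist (x k) (x i) ≤ 4 → k ∈ Ω) →
      ∀ j : Fin N, j ∉ Ω →
        ∃ b ∈ Ω, (∃ k : Fin N, k ∉ Ω ∧ dist (x k) (x b) ≤ 4) ∧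
          ∃ t : ℝ, 0 ≤ t ∧ t ≤ 1 ∧ dist (x b) (x i + t • (x j - x i)) ≤ 1 := by
  intro N x Ω hΩ i hi hint j hj
  classical
  -- the moving point and the interior particles
  set γ : ℝ → EuclideanSpace ℝ (Fin 3) := fun t => x i + t • (x j - x i) with hγ
  have hγc : Continuous γ := continuous_const.add (continuous_id.smul continuous_const)
  set A : Finset (Fin N) := Ω.filter (fun a => ∀ k : Fin N, dist (x k) (x a) ≤ 4 → k ∈ Ω) with hA
  have hiA : i ∈ A := Finset.mem_filter.2 ⟨hi, hint⟩
  -- interior particles have all-good 4-balls and are far from `j`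
  have hgoodA : ∀ a ∈ A, ∀ k : Fin N, dist (x k) (x a) ≤ 4 →
      IsTwoShellGood (1 / 20) (47 / 50) 1 x k := fun a ha k hk =>
    hΩ k ((Finset.mem_filter.1 ha).2 k hk)
  have hfarA : ∀ a ∈ A, 4 < dist (x j) (x a) := by
    intro a ha
    by_contra h
    exact hj ((Finset.mem_filter.1 ha).2 j (not_lt.1 h))
  -- the set of parameters at which the moving point is within `1` of an interior particle
  set S : Set ℝ := Set.Icc 0 1 ∩ ⋃ a ∈ A, {t | dist (γ t) (x a) ≤ 1} with hS
  have hSclosed : IsClosed S := by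
    refine isClosed_Icc.inter (isClosed_biUnion_finset fun a _ => ?_)
    exact isClosed_le (hγc.dist continuous_const) continuous_const
  have h0S : (0 : ℝ) ∈ S := by
    refine ⟨⟨le_rfl, zero_le_one⟩, Set.mem_iUnion₂.2 ⟨i, hiA, ?_⟩⟩
    show dist (γ 0) (x i) ≤ 1
    simp [hγ]
  have hSne : S.Nonempty := ⟨0, h0S⟩
  have hSbdd : BddAbove S := ⟨1, fun t ht => ht.1.2⟩
  set ts := sSup S with hts
  have htsS : ts ∈ S := hSclosed.csSup_mem hSne hSbdd
  obtain ⟨⟨hts0, hts1⟩, htsU⟩ := htsS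
  obtain ⟨a', ha'A, ha'⟩ := Set.mem_iUnion₂.1 htsU
  have ha'1 : dist (γ ts) (x a') ≤ 1 := ha'
  -- the length of the segment
  set r := dist (x i) (x j) with hr
  have hr4 : 4 < r := by rw [hr, dist_comm]; exact hfarA i hiA
  have hr0 : 0 < r := by linarith
  -- the next parameter
  set t' := min 1 (ts + 1 / r) with ht'
  have ht'1 : t' ≤ 1 := min_le_left _ _
  have ht'0 : 0 ≤ t' := le_min zero_le_one (by positivity)
  have htt' : ts < t' := lt_min_iff.2 ⟨?_, by simp [hr0]⟩
  swap
  · -- `ts < 1`: at `t = 1` the point is `x j`, farther than `4 > 1` from every interior particle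
    rcases lt_or_eq_of_le hts1 with h | h
    · exact h
    · exfalso
      have h1 := ha'1
      rw [h] at h1
      have hγ1 : γ 1 = x j := by simp [hγ]
      rw [hγ1] at h1
      linarith [hfarA a' ha'A]
  have hdt : t' - ts ≤ 1 / r := by
    have := min_le_right 1 (ts + 1 / r)
    linarith
  -- the moved point is within `2` of `a'`
  have hγγ : dist (γ t') (γ ts) ≤ 1 := by
    have : γ t' - γ ts = (t' - ts) • (x j - x i) := by
      simp only [hγ]; rw [sub_smul]; abel
    rw [dist_eq_norm, this, norm_smul, Real.norm_of_nonneg (by linarith), ← dist_eq_norm, dist_comm,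
      ← hr]
    calc (t' - ts) * r ≤ 1 / r * r := mul_le_mul_of_nonneg_right hdt hr0.le
      _ = 1 := by field_simp
  have hy2 : dist (γ t') (x a') ≤ 2 := by
    calc dist (γ t') (x a') ≤ dist (γ t') (γ ts) + dist (γ ts) (x a') := dist_triangle _ _ _
      _ ≤ 1 + 1 := add_le_add hγγ ha'1
      _ = 2 := by norm_num
  -- cover: a particle `p` within `1` of the moved point and within `4` of `a'`
  obtain ⟨p, hp1, hp4⟩ := segment_cover x a' (hgoodA a' ha'A) (γ t') hy2
  have hpΩ : p ∈ Ω := (Finset.mem_filter.1 ha'A).2 p hp4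
  -- `p` is not interior, by maximality of `ts`
  have hpA : p ∉ A := by
    intro hpA
    have ht'S : t' ∈ S := ⟨⟨ht'0, ht'1⟩, Set.mem_iUnion₂.2 ⟨p, hpA, hp1⟩⟩
    have := le_csSup hSbdd ht'S
    linarith
  have hpb : ∃ k : Fin N, k ∉ Ω ∧ dist (x k) (x p) ≤ 4 := by
    by_contra h
    push Not at h
    exact hpA (Finset.mem_filter.2 ⟨hpΩ, fun k hk => by_contra fun hk' => absurd hk (not_le.2 (h k hk'))⟩)
  refine ⟨p, hpΩ, hpb, t', ht'0, ht'1, ?_⟩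
  rw [dist_comm]
  exact hp1

end Summit.AtomisticToContinuum.Crystallization.Theorems.PhononSlackNearFieldConvexity
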